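import Literature.NumberTheory.LFunctions.WeilTwoPrimeCellsT120
import Literature.NumberTheory.LFunctions.WeilTwoPrimeMinorant
import Literature.NumberTheory.LFunctions.WeilTwoPrimeCellsT120Check0
import Literature.NumberTheory.LFunctions.WeilTwoPrimeCellsT120Check1
import Literature.NumberTheory.LFunctions.WeilTwoPrimeCellsT120Check2
import Literature.NumberTheory.LFunctions.WeilTwoPrimeCellsT120Check3
import Literature.NumberTheory.LFunctions.WeilTwoPrimeCellsT120Check4
import Literature.NumberTheory.LFunctions.WeilTwoPrimeCellsT120Check5
import HarnessLib

/-!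
# Two-prime minorant cells on `[0, 120]`: the chain is valid (`CellsOK₂₃`, assembly)

The multi-precision chain check `checkCells₂₃MP 120 5 weilTwoPrimeCellsT120MP wL 120 40000 weilTwoPrimeCellsT120` from its kernel-checked parts (chain test, per-chunk cell checks, dyadic `T`, level test `wL + cZeroFI.hiQ + cThreeFI.hiQ ≤ wLoZ 120 (dyNum 120 5) 5 40000`), and **`cellsOK_weilTwoPrimeCellsT120 : CellsOK₂₃ weilTwoPrimeCellsT120Level 120 weilTwoPrimeCellsT120`** (`cellsOK_of_parts₂₃MP`), the hypothesis of `WeilCert23.margin_step3_of_cellsOK`. Pure proof file.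
-/

noncomputable section

namespace Literature.NumberTheory.LFunctions

/-- The chain test (cheap). [folklore] -/
theorem checkChain_weilTwoPrimeCellsT120 : checkChain₂₃ weilTwoPrimeCellsT120 0 120 = true := by
  decide +kernel

set_option maxHeartbeats 0 in
/-- The level test at `T = 120` against the integer digamma bound. [folklore] -/
theorem checkLevel_weilTwoPrimeCellsT120 :
    decide (weilTwoPrimeCellsT120Level + cZeroFI.hiQ + cThreeFI.hiQ ≤ wLoZ 120 3840 5 40000) = true := by
  decide +kernel

/-- `dyNum 120 5 = 3840`. [folklore] -/
theorem dyNumT_weilTwoPrimeCellsT120 : dyNum (120 : ℚ) 5 = 3840 := by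
  decide +kernel

/-- The dyadic representation test of `T`. [folklore] -/
theorem checkTdy_weilTwoPrimeCellsT120 : (120 : ℚ) * 2 ^ 5 = ((dyNum (120 : ℚ) 5 : ℕ) : ℚ) := by
  rw [dyNumT_weilTwoPrimeCellsT120]; norm_num

/-- All cells of the chain on `[0, 120]` pass the multi-precision check. [folklore] -/
theorem checkCellsAll_weilTwoPrimeCellsT120 : (weilTwoPrimeCellsT120.all fun c ↦ c.checkZMP 120 5 weilTwoPrimeCellsT120MP) = true := by
  simp only [weilTwoPrimeCellsT120, List.all_append, checkCells_weilTwoPrimeCellsT120C0, checkCells_weilTwoPrimeCellsT120C1, checkCells_weilTwoPrimeCellsT120C2, checkCells_weilTwoPrimeCellsT120C3, checkCells_weilTwoPrimeCellsT120C4, checkCells_weilTwoPrimeCellsT120C5, Bool.and_self]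

/-- **The two-prime minorant chain on `[0, 120]` is valid**: consecutive valid cells from `0` to `120` and the level `wL ≤ w₂₃(t)` for `|t| ≥ 120`. [folklore] -/
theorem cellsOK_weilTwoPrimeCellsT120 : CellsOK₂₃ weilTwoPrimeCellsT120Level 120 weilTwoPrimeCellsT120 := by
  refine cellsOK_of_parts₂₃MP (p := 120) (j := 5) (P := weilTwoPrimeCellsT120MP) (mwT := 40000) checkChain_weilTwoPrimeCellsT120 checkCellsAll_weilTwoPrimeCellsT120 (by norm_num) checkTdy_weilTwoPrimeCellsT120 ?_
  have h := checkLevel_weilTwoPrimeCellsT120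
  rw [dyNumT_weilTwoPrimeCellsT120]
  exact of_decide_eq_true h

end Literature.NumberTheory.LFunctions
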